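import Literature.Barriers.CriticalPhenomena.RigorousRGSmallParameterFRDGradientBounds
import Literature.Barriers.CriticalPhenomena.RigorousRGSmallParameterFRDContinuumApproximation
import HarnessLib

/-!
# `RigorousRGSmallParameter` (Slade, Theorem 1.4.1): the self-similarity (10.38) of the
# finite-range decomposition — the lattice kernel `w(t,x;s)` against its continuum limit

Second file of the §10.3 layer ("Self-similarity of the covariance decomposition"), after
`RigorousRGSmallParameterFRDContinuumApproximation.lean` (Bauerschmidt's Proposition 3.1, `W*_t` vs
`W_t`). Sources. G. Slade, *Critical exponents for long-range `O(n)` models below the upper critical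
dimension*, Commun. Math. Phys. **358** (2018), §10.3: "We recall that there is a function `w̄` such
that `w` of (3.x) obeys (10.38) `w(t,x;s) = (c/t)^{d-2}w̄(cx/t;st²) + O(t^{-(d-1)}(1+st²)^{-p})`, with the
error estimate valid for any `p ≥ 0` and uniform in bounded `s`, and in particular for `s ≤ 1` (see
[Baue13a]; `w` is called `φ*` in [BBS-rg-pt, Baue13a], and `w̄` is `φ̄` of [Baue13a]). For any `p ≥ 0`,
the function `w̄` obeys (by [Baue13a]) (10.39) `w̄(cx/t;st²) ≤ O(1+st²)^{-p}`. It is shown in [Baue13a]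
that (10.40) `w̄(y,m²) = ∫Φ(√(|ξ|²+m²))e^{iy·ξ}dξ`, where `Φ` is a nonnegative function." R. Bauerschmidt,
*A simple method for finite range decomposition of quadratic forms and Gaussian fields*, PTRF **157**
(2013), Example 1.3: the lattice kernel `φ*_t(x,y;a,m²) = t²∫_{[-π,π]^d}W*_t(a*(ξ)+m²)e^{iξ·(x-y)}dξ`,
the continuum kernel `φ_t(x,y;a,m²) = t²∫_{ℝ^d}W_t(a(ξ)+m²)e^{i(x-y)·ξ}dξ = t^{-(d-2)}φ̄((x-y)/t;a,m²t²)`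
("this is scale invariance"), and (eq:const-coeff-w-w*-approximation) "`∇^{l_x}_x∇^{l_y}_yφ*_t(x,y;a,m²)
= D^{l_x}_xD^{l_y}_yφ_t(cx,cy;a,m²) + O(t^{-(d-2)-l_x-l_y-1}(1+m²t²)^{-k})`", proved in his §3.2.2 by
four differences — Proposition 3.1 (`W*_t` vs `W_t`), "`|a*(ξ) - a(ξ)| = O(|ξ|³)`, which follows from
Taylor's theorem", `∇̂` vs `D̂` (void for `l = 0`), and the tail `∫_{ℝ^d∖[-π,π]^d}` by (eq:W-decay).

In our normalisation (`RigorousRGSmallParameterFRDDecomposition.lean`): `ŵ(t,k) = (t²/(cM²))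
P_t((λ(k)+s)/M²)`, `M² = 2d+s`, `c = cProfile`, `w(t,x) = (2π)^{-d}∫_{[-π,π]^d}ŵ(t,k)cos(k·x)dk`;
`P_t = W*_t` for the profile `f = Re profile`, and `W_t(ζ) = f(t√ζ)`.

## What this file does (everything is proved; four definitions, no named fact)

* `FRD.sqNorm` (`|k|₂²`), `FRD.wHatCont` (`ŵ_c(t,k) = (t²/(cM²))f(t√((|k|₂²+s)/M²))`), `FRD.wHatMid`
  (`(t²/(cM²))f(t√((λ(k)+s)/M²))`), `FRD.wKerCont` (`w_c(t,x;s) = (2π)^{-d}∫_{ℝ^d}ŵ_c cos(k·x)dk`),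
  `FRD.wbar` (`w̄(y;σ) = (2π)^{-d}∫_{ℝ^d}f(√(|u|₂²+σ))cos(u·y)du`, Bauerschmidt's `φ̄` for our profile).
* `FRD.sqNorm_sub_laplaceSymbol_bounds` (`0 ≤ |k|₂² - λ(k) ≤ 20d‖k‖_∞⁴` on the Brillouin zone),
  `FRD.one_add_norm_smul_sq_le_sqNorm`,
  `FRD.setIntegral_le_of_le_mul_comp_smul` (the rescaling step `∫_S F ≤ K a^{-d}∫g` when `F ≤ Kg(a·)`),
  `FRD.pi_sq_lt_sqNorm_of_not_mem`; the three pointwise comparisons `FRD.abs_wHat_sub_wHatMid_le`,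
  `FRD.abs_wHatMid_sub_wHatCont_le`, `FRD.abs_wHatCont_le`.
* **`FRD.abs_wKer_sub_wKerCont_le`** — **(10.38) for the explicit decomposition, PROVED**: for
  `d ≥ 1` and every `p` there is `C(d,p)` with `|w(t,x;s) - w_c(t,x;s)| ≤ C(t²/t^d)t⁻¹(1+t²s/(2d+s))^{-p}`
  for all `s ∈ (0,1]`, `t ≥ 1`, `x ∈ ℤ^d`.
* **`FRD.wKerCont_eq_scaling`** — scale invariance: `w_c(t,x;s) = (M/t)^d(t²/(cM²))w̄(Mx/t; st²/M²)`,
  i.e. `w_c = c⁻¹(M/t)^{d-2}w̄(Mx/t; st²/M²)` (`M = √(2d+s)`).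

Scope / reading. (i) Slade's (10.38) leaves the constant `c` of `(c/t)^{d-2}w̄(cx/t; st²)` unspecified;
here it is `M = √(2d+s)` (which depends on `s`, `M² ∈ [2d,2d+1]` for `s ≤ 1`), the normalisation is
`cProfile⁻¹`, and the second argument of `w̄` is `st²/M²`. (ii) Only `l_x = l_y = 0` (no lattice
gradients) and the identity coefficient matrix are treated. (iii) The decay (10.39) of `w̄` and the
Fourier positivity (10.40) are not in this file.
-/

noncomputable section

namespace Literature.Barriers.CriticalPhenomena

open _root_.MeasureTheory Set Filter
open scoped _root_.Topology Real FourierTransform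

namespace LongRangePhi4

namespace FRD

open Literature.Probability.LatticeModels

variable {d : ℕ}

/-! ### The Euclidean square norm and the continuum symbol -/

/-- `|k|₂² = Σ_i k_i²`, the symbol of the continuum Laplacian `a(ξ) = |ξ|²` of [Baue13a].
[cite: Bauerschmidt2013, §3.2.1 (display defining a(ξ), identity coefficients)] -/
def sqNorm (k : Fin d → ℝ) : ℝ := ∑ i, k i ^ 2

/-- `|k|₂² ≥ 0`. [folklore] -/
theorem sqNorm_nonneg (k : Fin d → ℝ) : 0 ≤ sqNorm k := Finset.sum_nonneg fun _ _ => sq_nonneg _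

/-- `‖k‖_∞² ≤ |k|₂²`. [folklore] -/
theorem norm_sq_le_sqNorm (k : Fin d → ℝ) : ‖k‖ ^ 2 ≤ sqNorm k := by
  have h : ‖k‖ ≤ Real.sqrt (sqNorm k) := by
    refine (pi_norm_le_iff_of_nonneg (Real.sqrt_nonneg _)).2 fun i => ?_
    rw [Real.norm_eq_abs, ← Real.sqrt_sq_eq_abs]
    exact Real.sqrt_le_sqrt (Finset.single_le_sum (f := fun j => k j ^ 2) (fun j _ => sq_nonneg _)
      (Finset.mem_univ i))
  calc ‖k‖ ^ 2 ≤ Real.sqrt (sqNorm k) ^ 2 := pow_le_pow_left₀ (norm_nonneg _) h 2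
    _ = sqNorm k := Real.sq_sqrt (sqNorm_nonneg k)

/-- `|k|₂² ≤ d‖k‖_∞²`. [folklore] -/
theorem sqNorm_le (k : Fin d → ℝ) : sqNorm k ≤ d * ‖k‖ ^ 2 := by
  unfold sqNorm
  calc ∑ i, k i ^ 2 ≤ ∑ _i : Fin d, ‖k‖ ^ 2 := Finset.sum_le_sum fun i _ => by
        rw [← sq_abs]
        exact pow_le_pow_left₀ (abs_nonneg _) (by simpa using norm_le_pi_norm k i) 2
    _ = d * ‖k‖ ^ 2 := by simp

/-- **The lattice symbol is below the continuum one and fourth-order close on the Brillouin zone**: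
`0 ≤ |k|₂² - λ(k) ≤ 20 d ‖k‖_∞⁴` for `k ∈ [-π,π]^d` ("`|a*(ξ) - a(ξ)| = O(|ξ|³)`, which follows from
Taylor's theorem"; here `λ(k) = 2Σ(1 - cos k_i)` is even, so the discrepancy is fourth order).
[cite: Bauerschmidt2013, §3.2.2 (proof of (eq:const-coeff-w-w*-approximation): |a*(ξ) - a(ξ)| = O(|ξ|³))] -/
theorem sqNorm_sub_laplaceSymbol_bounds {k : Fin d → ℝ} (hk : k ∈ brillouin d) :
    0 ≤ sqNorm k - laplaceSymbol k ∧ sqNorm k - laplaceSymbol k ≤ 20 * d * ‖k‖ ^ 4 := by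
  have hcoord : ∀ i, 0 ≤ k i ^ 2 - 2 * (1 - Real.cos (k i)) ∧
      k i ^ 2 - 2 * (1 - Real.cos (k i)) ≤ 20 * ‖k‖ ^ 4 := by
    intro i
    have hki : |k i| ≤ ‖k‖ := by simpa using norm_le_pi_norm k i
    have hkπ : |k i| ≤ π := abs_le.2 (hk i (Set.mem_univ _))
    constructor
    · have := Real.one_sub_sq_div_two_le_cos (x := k i)
      linarith
    · rcases le_or_gt |k i| 1 with h1 | h1
      · have hb := Real.cos_bound h1
        rw [abs_le] at hb
        have h4 : |k i| ^ 4 ≤ ‖k‖ ^ 4 := pow_le_pow_left₀ (abs_nonneg _) hki 4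
        have e4 : |k i| ^ 4 = k i ^ 4 := by
          rw [show |k i| ^ 4 = (|k i| ^ 2) ^ 2 by ring, sq_abs]
          ring
        nlinarith [hb.1, hb.2]
      · -- `1 ≤ |k_i| ≤ π`: crude
        have hc1 := Real.cos_le_one (k i)
        have h2 : k i ^ 2 ≤ π ^ 2 := by
          rw [← sq_abs]; exact pow_le_pow_left₀ (abs_nonneg _) hkπ 2
        have h3 : (1 : ℝ) ≤ ‖k‖ ^ 4 := one_le_pow₀ (le_trans h1.le hki)
        have hπ4 : π ^ 2 ≤ 16 := by nlinarith [Real.pi_le_four, Real.pi_pos]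
        nlinarith
  constructor
  · unfold sqNorm laplaceSymbol dispersion
    rw [Finset.mul_sum, ← Finset.sum_sub_distrib]
    exact Finset.sum_nonneg fun i _ => by linarith [(hcoord i).1]
  · unfold sqNorm laplaceSymbol dispersion
    rw [Finset.mul_sum, ← Finset.sum_sub_distrib]
    calc ∑ i, (k i ^ 2 - 2 * (1 - Real.cos (k i))) ≤ ∑ _i : Fin d, 20 * ‖k‖ ^ 4 :=
          Finset.sum_le_sum fun i _ => (hcoord i).2
      _ = 20 * d * ‖k‖ ^ 4 := by simp; ring

/-- **The continuum symbol** `ŵ_c(t,k) = (t²/(cM²)) f(t√((|k|₂²+s)/M²))`, `M² = 2d + s`, `f = Re profile`: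
the symbol `ŵ` of the decomposition with the Chebyshev profile `P_t(ζ)` replaced by `f(t√ζ)` and the
lattice symbol `λ(k)` by `|k|₂²` — Bauerschmidt's `t²W_t(a(ξ) + ·)` for our normalised profile.
[cite: Bauerschmidt2013, §3.2.2 (display: φ_t(x,y;a,m²) = t²∫W_t(a(ξ)+m²)e^{i(x-y)·ξ}dξ)] -/
def wHatCont (d : ℕ) (s t : ℝ) (k : Fin d → ℝ) : ℝ :=
  t ^ 2 / (cProfile * (2 * d + s)) * (profile (t * Real.sqrt ((sqNorm k + s) / (2 * d + s)))).re

/-- **The continuum kernel** `w_c(t,x;s) = (2π)^{-d}∫_{ℝ^d} ŵ_c(t,k) cos(k·x) dk` (evaluated at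
lattice points `x ∈ ℤ^d`) — Bauerschmidt's `φ_t(x,0)` for the normalised profile, the continuum
object of the self-similarity statement (10.38) of Slade. [cite: Bauerschmidt2013, §3.2.2 (display: φ_t = t²∫_{ℝ^d}W_t(a(ξ)+m²)e^{iξ·x}dξ)] [cite: Slade2017, §10.3 (display (10.38))] -/
def wKerCont (d : ℕ) (s t : ℝ) (x : Site d) : ℝ :=
  ((2 * π) ^ d : ℝ)⁻¹ * ∫ k, wHatCont d s t k * Real.cos (phase k x)

/-- The intermediate symbol `(t²/(cM²)) f(t√ζ(k))`, `ζ(k) = (λ(k)+s)/M²`: the continuum profile at the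
lattice symbol. [cite: Bauerschmidt2013, §3.2.2 (proof of (eq:const-coeff-w-w*-approximation), the term W_t(a*(ξ)+m²))] -/
def wHatMid (d : ℕ) (s t : ℝ) (k : Fin d → ℝ) : ℝ :=
  t ^ 2 / (cProfile * (2 * d + s)) * (profile (t * Real.sqrt ((laplaceSymbol k + s) / (2 * d + s)))).re

/-! ### Continuity / measurability of the symbols -/

/-- `k ↦ ŵ_c(t,k)` is continuous. [folklore] -/
theorem continuous_wHatCont (s t : ℝ) : Continuous (wHatCont d s t) := by
  have hsq : Continuous (sqNorm : (Fin d → ℝ) → ℝ) := by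
    unfold sqNorm
    fun_prop
  unfold wHatCont
  refine continuous_const.mul (Complex.continuous_re.comp (profile.continuous.comp
    (continuous_const.mul ((hsq.add continuous_const).div_const _).sqrt)))

/-- `k ↦ ŵ_mid(t,k)` is continuous. [folklore] -/
theorem continuous_wHatMid (s t : ℝ) : Continuous (wHatMid d s t) := by
  unfold wHatMid laplaceSymbol
  refine continuous_const.mul (Complex.continuous_re.comp (profile.continuous.comp
    (continuous_const.mul ((((continuous_const.mul (continuous_dispersion d)).add
      continuous_const).div_const _).sqrt))))

/-! ### Integration against a rescaled majorant -/

/-- **The rescaling step of the printed integral estimates**: if `0 ≤ F ≤ K g(a·)` on a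
measurable set `S` with `g ≥ 0` integrable on `ℝ^d`, `K ≥ 0`, `a > 0`, then `F` is integrable on
`S` and `∫_S F ≤ K a^{-d}∫_{ℝ^d} g` ("the change of variables `ξ ↦ tξ`"). [cite: Bauerschmidt2013, §3.2.2 (proofs: "by the change of variables ξ ↦ tξ")] -/
theorem setIntegral_le_of_le_mul_comp_smul {S : Set (Fin d → ℝ)} (hS : MeasurableSet S)
    {F g : (Fin d → ℝ) → ℝ} (hF : AEStronglyMeasurable F ((volume : Measure (Fin d → ℝ)).restrict S))
    (hF0 : ∀ k ∈ S, 0 ≤ F k) (hg : Integrable g) (hg0 : ∀ u, 0 ≤ g u) {K a : ℝ} (hK : 0 ≤ K)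
    (ha : 0 < a) (hle : ∀ k ∈ S, F k ≤ K * g (a • k)) :
    IntegrableOn F S ∧ ∫ k in S, F k ≤ K * ((a ^ d)⁻¹ * ∫ u, g u) := by
  have hKgi : Integrable (fun k : Fin d → ℝ => K * g (a • k)) :=
    (hg.comp_smul ha.ne').const_mul K
  have hFi : IntegrableOn F S := by
    refine Integrable.mono' hKgi.integrableOn hF ((ae_restrict_iff' hS).2
      (Eventually.of_forall fun k hk => ?_))
    rw [Real.norm_eq_abs, abs_of_nonneg (hF0 k hk)]
    exact hle k hk
  refine ⟨hFi, ?_⟩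
  have hstep1 : ∫ k in S, F k ≤ ∫ k in S, K * g (a • k) :=
    setIntegral_mono_on hFi hKgi.integrableOn hS hle
  have hstep2 : ∫ k in S, K * g (a • k) ≤ ∫ k, K * g (a • k) :=
    setIntegral_le_integral hKgi (Eventually.of_forall fun k => mul_nonneg hK (hg0 _))
  have hstep3 : ∫ k : Fin d → ℝ, K * g (a • k) = K * ((a ^ d)⁻¹ * ∫ u, g u) := by
    rw [integral_const_mul, Measure.integral_comp_smul volume g a, Module.finrank_fin_fun,
      abs_of_nonneg (inv_nonneg.2 (pow_nonneg ha.le _)), smul_eq_mul]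
  linarith [hstep1, hstep2, hstep3.le, hstep3.ge]

/-! ### The three pointwise comparisons -/

/-- The scaled decay weight dominates on all of `ℝ^d`: `1 + ‖(2t/(πM))k‖² ≤ 1 + t²|k|₂²/M²`.
[cite: Bauerschmidt2013, §3.2.2 ("the spectra of a(ξ) and a*(ξ) are bounded from above and from below by |ξ|²")] -/
theorem one_add_norm_smul_sq_le_sqNorm (k : Fin d → ℝ) {t M2 : ℝ} (ht : 0 ≤ t) (hM : 0 < M2) :
    1 + ‖(2 * t / (π * Real.sqrt M2)) • k‖ ^ 2 ≤ 1 + t ^ 2 * sqNorm k / M2 := by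
  have hsq : Real.sqrt M2 ^ 2 = M2 := Real.sq_sqrt hM.le
  have hsq0 : 0 < Real.sqrt M2 := Real.sqrt_pos.2 hM
  have hπ := Real.pi_pos
  rw [norm_smul, mul_pow, Real.norm_eq_abs, abs_of_nonneg (by positivity), div_pow, mul_pow, mul_pow,
    hsq]
  have h1 : (2 : ℝ) ^ 2 / π ^ 2 ≤ 1 := by
    rw [div_le_one (by positivity)]
    nlinarith [Real.two_le_pi, Real.pi_pos]
  have h2 : ‖k‖ ^ 2 ≤ sqNorm k := norm_sq_le_sqNorm k
  have h3 : (2 : ℝ) ^ 2 * t ^ 2 / (π ^ 2 * M2) * ‖k‖ ^ 2 = (2 ^ 2 / π ^ 2) * (t ^ 2 * ‖k‖ ^ 2 / M2) := by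
    field_simp
  rw [h3]
  have h4 : t ^ 2 * ‖k‖ ^ 2 / M2 ≤ t ^ 2 * sqNorm k / M2 :=
    div_le_div_of_nonneg_right (mul_le_mul_of_nonneg_left h2 (sq_nonneg t)) hM.le
  have h5 : 0 ≤ t ^ 2 * ‖k‖ ^ 2 / M2 := by positivity
  nlinarith

/-- **Comparison 1 (`W*_t` vs `W_t`)**: on the Brillouin zone, for `t ≥ 1`, `0 < s`,
`|ŵ(t,k) - ŵ_mid(t,k)| ≤ (t²/(cM²)) C t⁻¹ (1+t²s/M²)^{-p} (1+‖(2t/(πM))k‖²)^{-p'}`, by Proposition 3.1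
(`abs_chebyProfile_profile_sub_le` with `l = p + p'`) and the splitting of the decay factor.
[cite: Bauerschmidt2013, §3.2.2 (proof of (eq:const-coeff-w-w*-approximation), first display)] -/
theorem abs_wHat_sub_wHatMid_le (p p' : ℕ) :
    ∃ C : ℝ, 0 < C ∧ ∀ s : ℝ, 0 < s → ∀ t : ℝ, 1 ≤ t → ∀ k ∈ brillouin d,
      |wHat d s t k - wHatMid d s t k| ≤
        t ^ 2 / (cProfile * (2 * d + s)) * (C * t⁻¹) * ((1 + t ^ 2 * s / (2 * d + s)) ^ p)⁻¹ *
          ((1 + ‖(2 * t / (π * Real.sqrt (2 * d + s))) • k‖ ^ 2) ^ p')⁻¹ := by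
  obtain ⟨C, hC, hP⟩ := abs_chebyProfile_profile_sub_le (p + p')
  refine ⟨C, hC, fun s hs t ht k hk => ?_⟩
  have ht0 : 0 < t := by linarith
  have hM : 0 < 2 * (d : ℝ) + s := by positivity
  obtain ⟨hζ0, hζ4⟩ := spectralArg_mem hs k
  have h1 := hP t ht _ ⟨hζ0.le, hζ4.le⟩
  have h3 := inv_pow_add_le (t := t) (laplaceSymbol_nonneg k) hs.le hM p p'
  have h4 : ((1 + t ^ 2 * laplaceSymbol k / (2 * d + s)) ^ p')⁻¹ ≤
      ((1 + ‖(2 * t / (π * Real.sqrt (2 * d + s))) • k‖ ^ 2) ^ p')⁻¹ := by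
    apply inv_anti₀ (by positivity)
    exact pow_le_pow_left₀ (by positivity) (one_add_norm_smul_sq_le hk ht0.le hM) _
  have h5 : 0 ≤ t ^ 2 / (cProfile * (2 * d + s)) := by
    have := cProfile_pos; positivity
  unfold wHat wHatMid
  rw [← mul_sub, abs_mul, abs_of_nonneg h5]
  calc t ^ 2 / (cProfile * (2 * d + s)) *
        |chebyProfile (fun v => (profile v).re) t ((laplaceSymbol k + s) / (2 * d + s)) -
          (profile (t * Real.sqrt ((laplaceSymbol k + s) / (2 * d + s)))).re|
      ≤ t ^ 2 / (cProfile * (2 * d + s)) * (C * t⁻¹ *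
          (((1 + t ^ 2 * s / (2 * d + s)) ^ p)⁻¹ * ((1 + t ^ 2 * laplaceSymbol k / (2 * d + s)) ^ p')⁻¹)) := by
        refine mul_le_mul_of_nonneg_left (h1.trans ?_) h5
        exact mul_le_mul_of_nonneg_left h3 (by positivity)
    _ ≤ t ^ 2 / (cProfile * (2 * d + s)) * (C * t⁻¹ *
          (((1 + t ^ 2 * s / (2 * d + s)) ^ p)⁻¹ *
            ((1 + ‖(2 * t / (π * Real.sqrt (2 * d + s))) • k‖ ^ 2) ^ p')⁻¹)) := by
        gcongr
    _ = _ := by ring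

/-- **Comparison 2 (`λ(k)` vs `|k|₂²`)**: on the Brillouin zone, for `t ≥ 1`, `0 < s`,
`|ŵ_mid(t,k) - ŵ_c(t,k)| ≤ (t³√(20d)/(cM³)) C (1+t²s/M²)^{-p} ‖k‖² (1+‖(2t/(πM))k‖²)^{-q}` —
the mean value inequality for `f` between `t√ζ(k)` and `t√ζ_c(k)` (`ζ ≤ ζ_c`), the rapid decay
of `f'`, `√ζ_c - √ζ ≤ √(ζ_c - ζ) ≤ √(20d)‖k‖²/M`.
[cite: Bauerschmidt2013, §3.2.2 (proof of (eq:const-coeff-w-w*-approximation), second display: "Taylor's theorem")] -/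
theorem abs_wHatMid_sub_wHatCont_le (p q : ℕ) :
    ∃ C : ℝ, 0 < C ∧ ∀ s : ℝ, 0 < s → ∀ t : ℝ, 1 ≤ t → ∀ k ∈ brillouin d,
      |wHatMid d s t k - wHatCont d s t k| ≤
        t ^ 2 / (cProfile * (2 * d + s)) * (C * t * (Real.sqrt (20 * d) / Real.sqrt (2 * d + s))) *
          ((1 + t ^ 2 * s / (2 * d + s)) ^ p)⁻¹ *
          (‖k‖ ^ 2 * ((1 + ‖(2 * t / (π * Real.sqrt (2 * d + s))) • k‖ ^ 2) ^ q)⁻¹) := by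
  obtain ⟨C, hC, hF'⟩ := norm_deriv_le_div_one_add_pow profile (2 * (p + q))
  refine ⟨C, hC, fun s hs t ht k hk => ?_⟩
  have ht0 : 0 < t := by linarith
  have hM : 0 < 2 * (d : ℝ) + s := by positivity
  set M2 : ℝ := 2 * d + s with hM2
  have hsqM : Real.sqrt M2 ^ 2 = M2 := Real.sq_sqrt hM.le
  have hsqM0 : 0 < Real.sqrt M2 := Real.sqrt_pos.2 hM
  set ζ : ℝ := (laplaceSymbol k + s) / M2 with hζdef
  set ζc : ℝ := (sqNorm k + s) / M2 with hζcdef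
  obtain ⟨hsub0, hsub⟩ := sqNorm_sub_laplaceSymbol_bounds hk
  have hζ0 : 0 ≤ ζ := div_nonneg (add_nonneg (laplaceSymbol_nonneg k) hs.le) hM.le
  have hζζc : ζ ≤ ζc := div_le_div_of_nonneg_right (by linarith) hM.le
  have hdiff : Real.sqrt ζc - Real.sqrt ζ ≤ Real.sqrt (20 * d) / Real.sqrt M2 * ‖k‖ ^ 2 := by
    -- `√ζ_c - √ζ ≤ √(ζ_c - ζ)`
    have hss : Real.sqrt ζc - Real.sqrt ζ ≤ Real.sqrt (ζc - ζ) := by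
      have h0 : 0 ≤ Real.sqrt ζ + Real.sqrt (ζc - ζ) := by positivity
      have h1 : ζc ≤ (Real.sqrt ζ + Real.sqrt (ζc - ζ)) ^ 2 := by
        rw [add_sq, Real.sq_sqrt hζ0, Real.sq_sqrt (by linarith)]
        nlinarith [Real.sqrt_nonneg ζ, Real.sqrt_nonneg (ζc - ζ)]
      have := Real.sqrt_le_sqrt h1
      rw [Real.sqrt_sq h0] at this
      linarith
    refine hss.trans ?_
    have e : ζc - ζ = (sqNorm k - laplaceSymbol k) / M2 := by
      rw [hζcdef, hζdef]; field_simp; ring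
    rw [e]
    calc Real.sqrt ((sqNorm k - laplaceSymbol k) / M2) ≤ Real.sqrt (20 * d * ‖k‖ ^ 4 / M2) :=
          Real.sqrt_le_sqrt (div_le_div_of_nonneg_right hsub hM.le)
      _ = Real.sqrt (20 * d) / Real.sqrt M2 * ‖k‖ ^ 2 := by
          rw [Real.sqrt_div (by positivity), Real.sqrt_mul (by positivity),
            show ‖k‖ ^ 4 = (‖k‖ ^ 2) ^ 2 by ring, Real.sqrt_sq (sq_nonneg _)]
          ring
  -- the mean value inequality on `[t√ζ, t√ζ_c]`
  have hsζ : Real.sqrt ζ ≤ Real.sqrt ζc := Real.sqrt_le_sqrt hζζc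
  have hseg : ∀ u ∈ Icc (t * Real.sqrt ζ) (t * Real.sqrt ζc),
      ‖deriv profile u‖ ≤ C * ((1 + t * Real.sqrt ζ) ^ (2 * (p + q)))⁻¹ := by
    intro u hu
    have hu0 : 0 ≤ u := le_trans (by positivity) hu.1
    refine (hF' u).trans ?_
    rw [abs_of_nonneg hu0, div_eq_mul_inv]
    apply mul_le_mul_of_nonneg_left _ hC.le
    apply inv_anti₀ (by positivity)
    exact pow_le_pow_left₀ (by positivity) (by linarith [hu.1]) _
  have hmvt := Convex.norm_image_sub_le_of_norm_deriv_le (s := Icc (t * Real.sqrt ζ) (t * Real.sqrt ζc))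
    (fun u _ => profile.differentiableAt) hseg (convex_Icc _ _)
    (left_mem_Icc.2 (by nlinarith)) (right_mem_Icc.2 (by nlinarith))
  -- decay factor: `(1+t√ζ)^{2(p+q)} ≥ (1+t²ζ)^{p+q} ≥ (1+t²s/M²)^p (1+t²λ/M²)^q`
  have hdec : ((1 + t * Real.sqrt ζ) ^ (2 * (p + q)))⁻¹ ≤
      ((1 + t ^ 2 * s / M2) ^ p)⁻¹ * ((1 + ‖(2 * t / (π * Real.sqrt M2)) • k‖ ^ 2) ^ q)⁻¹ := by
    have h1 : (1 + t ^ 2 * ζ) ^ (p + q) ≤ (1 + t * Real.sqrt ζ) ^ (2 * (p + q)) := by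
      rw [pow_mul]
      apply pow_le_pow_left₀ (by positivity)
      have : (t * Real.sqrt ζ) ^ 2 = t ^ 2 * ζ := by rw [mul_pow, Real.sq_sqrt hζ0]
      nlinarith [mul_nonneg ht0.le (Real.sqrt_nonneg ζ)]
    have h2 := inv_pow_add_le (t := t) (laplaceSymbol_nonneg k) hs.le hM p q
    have h3 : ((1 + t ^ 2 * laplaceSymbol k / M2) ^ q)⁻¹ ≤
        ((1 + ‖(2 * t / (π * Real.sqrt M2)) • k‖ ^ 2) ^ q)⁻¹ := by
      apply inv_anti₀ (by positivity)
      exact pow_le_pow_left₀ (by positivity) (one_add_norm_smul_sq_le hk ht0.le hM) _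
    calc ((1 + t * Real.sqrt ζ) ^ (2 * (p + q)))⁻¹ ≤ ((1 + t ^ 2 * ζ) ^ (p + q))⁻¹ :=
          inv_anti₀ (by positivity) h1
      _ ≤ ((1 + t ^ 2 * s / M2) ^ p)⁻¹ * ((1 + t ^ 2 * laplaceSymbol k / M2) ^ q)⁻¹ := h2
      _ ≤ _ := mul_le_mul_of_nonneg_left h3 (by positivity)
  have h5 : 0 ≤ t ^ 2 / (cProfile * M2) := by
    have := cProfile_pos; positivity
  have key : ‖profile (t * Real.sqrt ζc) - profile (t * Real.sqrt ζ)‖ ≤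
      C * t * (Real.sqrt (20 * d) / Real.sqrt M2) * ((1 + t ^ 2 * s / M2) ^ p)⁻¹ *
        (‖k‖ ^ 2 * ((1 + ‖(2 * t / (π * Real.sqrt M2)) • k‖ ^ 2) ^ q)⁻¹) := by
    calc ‖profile (t * Real.sqrt ζc) - profile (t * Real.sqrt ζ)‖
        ≤ C * ((1 + t * Real.sqrt ζ) ^ (2 * (p + q)))⁻¹ * ‖t * Real.sqrt ζc - t * Real.sqrt ζ‖ := hmvt
      _ ≤ C * (((1 + t ^ 2 * s / M2) ^ p)⁻¹ * ((1 + ‖(2 * t / (π * Real.sqrt M2)) • k‖ ^ 2) ^ q)⁻¹) *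
            (t * (Real.sqrt (20 * d) / Real.sqrt M2 * ‖k‖ ^ 2)) := by
          refine mul_le_mul (mul_le_mul_of_nonneg_left hdec hC.le) ?_ (norm_nonneg _) (by positivity)
          rw [← mul_sub, norm_mul, Real.norm_eq_abs, abs_of_nonneg ht0.le, Real.norm_eq_abs,
            abs_of_nonneg (by linarith)]
          exact mul_le_mul_of_nonneg_left hdiff ht0.le
      _ = _ := by ring
  unfold wHatMid wHatCont
  rw [← hM2, ← mul_sub, abs_mul, abs_of_nonneg h5, ← Complex.sub_re]
  calc t ^ 2 / (cProfile * M2) * |(profile (t * Real.sqrt ζ) - profile (t * Real.sqrt ζc)).re|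
      ≤ t ^ 2 / (cProfile * M2) * ‖profile (t * Real.sqrt ζ) - profile (t * Real.sqrt ζc)‖ :=
        mul_le_mul_of_nonneg_left (Complex.abs_re_le_norm _) h5
    _ = t ^ 2 / (cProfile * M2) * ‖profile (t * Real.sqrt ζc) - profile (t * Real.sqrt ζ)‖ := by
        rw [← norm_neg, neg_sub]
    _ ≤ t ^ 2 / (cProfile * M2) * (C * t * (Real.sqrt (20 * d) / Real.sqrt M2) *
          ((1 + t ^ 2 * s / M2) ^ p)⁻¹ *
          (‖k‖ ^ 2 * ((1 + ‖(2 * t / (π * Real.sqrt M2)) • k‖ ^ 2) ^ q)⁻¹)) :=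
        mul_le_mul_of_nonneg_left key h5
    _ = _ := by ring

/-- **Comparison 3 (the continuum symbol itself)**: for all `k ∈ ℝ^d`, `t ≥ 0`, `s > 0`,
`|ŵ_c(t,k)| ≤ (t²/(cM²)) C (1+t²s/M²)^{-p} (1+t²|k|₂²/M²)^{-r} (1+‖(2t/(πM))k‖²)^{-q}` (rapid decay of
`f`), the pointwise input of the tail estimate and of the integrability of `ŵ_c`.
[cite: Bauerschmidt2013, §3.2.2 (proof of (eq:const-coeff-w-w*-approximation), last display: (eq:W-decay) off the Brillouin zone)] -/
theorem abs_wHatCont_le (p q r : ℕ) :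
    ∃ C : ℝ, 0 < C ∧ ∀ s : ℝ, 0 < s → ∀ t : ℝ, 0 ≤ t → ∀ k : Fin d → ℝ,
      |wHatCont d s t k| ≤ t ^ 2 / (cProfile * (2 * d + s)) * C *
        ((1 + t ^ 2 * s / (2 * d + s)) ^ p)⁻¹ * ((1 + t ^ 2 * sqNorm k / (2 * d + s)) ^ r)⁻¹ *
        ((1 + ‖(2 * t / (π * Real.sqrt (2 * d + s))) • k‖ ^ 2) ^ q)⁻¹ := by
  obtain ⟨C, hC, hf⟩ := abs_profile_sqrt_le profile (p + r + q)
  refine ⟨C, hC, fun s hs t ht k => ?_⟩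
  have hM : 0 < 2 * (d : ℝ) + s := by positivity
  have hζc0 : 0 ≤ (sqNorm k + s) / (2 * d + s) := div_nonneg (add_nonneg (sqNorm_nonneg k) hs.le) hM.le
  have h1 := hf t ht _ hζc0
  -- split the decay factor in three
  have hA : 1 + t ^ 2 * s / (2 * d + s) ≤ 1 + t ^ 2 * ((sqNorm k + s) / (2 * d + s)) := by
    have : t ^ 2 * s / (2 * d + s) ≤ t ^ 2 * ((sqNorm k + s) / (2 * d + s)) := by
      rw [mul_div_assoc]
      exact mul_le_mul_of_nonneg_left (div_le_div_of_nonneg_right (by linarith [sqNorm_nonneg k]) hM.le)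
        (sq_nonneg t)
    linarith
  have hB : 1 + t ^ 2 * sqNorm k / (2 * d + s) ≤ 1 + t ^ 2 * ((sqNorm k + s) / (2 * d + s)) := by
    have : t ^ 2 * sqNorm k / (2 * d + s) ≤ t ^ 2 * ((sqNorm k + s) / (2 * d + s)) := by
      rw [mul_div_assoc]
      exact mul_le_mul_of_nonneg_left (div_le_div_of_nonneg_right (by linarith) hM.le) (sq_nonneg t)
    linarith
  have hCq : 1 + ‖(2 * t / (π * Real.sqrt (2 * d + s))) • k‖ ^ 2 ≤ 1 + t ^ 2 * ((sqNorm k + s) / (2 * d + s)) :=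
    (one_add_norm_smul_sq_le_sqNorm k ht hM).trans hB
  have hA0 : 0 < 1 + t ^ 2 * s / (2 * d + s) := by positivity
  have hB0 : 0 < 1 + t ^ 2 * sqNorm k / (2 * d + s) := by
    have := sqNorm_nonneg k; positivity
  have hC0 : 0 < 1 + ‖(2 * t / (π * Real.sqrt (2 * d + s))) • k‖ ^ 2 := by positivity
  have hsplit : ((1 + t ^ 2 * ((sqNorm k + s) / (2 * d + s))) ^ (p + r + q))⁻¹ ≤
      ((1 + t ^ 2 * s / (2 * d + s)) ^ p)⁻¹ * ((1 + t ^ 2 * sqNorm k / (2 * d + s)) ^ r)⁻¹ *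
        ((1 + ‖(2 * t / (π * Real.sqrt (2 * d + s))) • k‖ ^ 2) ^ q)⁻¹ := by
    rw [← mul_inv, ← mul_inv, pow_add, pow_add]
    apply inv_anti₀ (by positivity)
    exact mul_le_mul (mul_le_mul (pow_le_pow_left₀ hA0.le hA p) (pow_le_pow_left₀ hB0.le hB r)
      (by positivity) (by positivity)) (pow_le_pow_left₀ hC0.le hCq q) (by positivity) (by positivity)
  have h5 : 0 ≤ t ^ 2 / (cProfile * (2 * d + s)) := by
    have := cProfile_pos; positivity
  unfold wHatCont
  rw [abs_mul, abs_of_nonneg h5]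
  calc t ^ 2 / (cProfile * (2 * d + s)) * |(profile (t * Real.sqrt ((sqNorm k + s) / (2 * d + s)))).re|
      ≤ t ^ 2 / (cProfile * (2 * d + s)) * (C * ((1 + t ^ 2 * ((sqNorm k + s) / (2 * d + s))) ^ (p + r + q))⁻¹) :=
        mul_le_mul_of_nonneg_left h1 h5
    _ ≤ t ^ 2 / (cProfile * (2 * d + s)) * (C * (((1 + t ^ 2 * s / (2 * d + s)) ^ p)⁻¹ *
          ((1 + t ^ 2 * sqNorm k / (2 * d + s)) ^ r)⁻¹ *
          ((1 + ‖(2 * t / (π * Real.sqrt (2 * d + s))) • k‖ ^ 2) ^ q)⁻¹)) := by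
        gcongr
    _ = _ := by ring

/-! ### The kernel comparison: Slade (10.38) / Bauerschmidt (1.x) for the explicit decomposition -/

/-- Off the Brillouin zone some coordinate exceeds `π`, so `|k|₂² > π²`. [folklore] -/
theorem pi_sq_lt_sqNorm_of_not_mem {k : Fin d → ℝ} (hk : k ∉ brillouin d) : π ^ 2 < sqNorm k := by
  have : ∃ i, π < |k i| := by
    by_contra h
    exact hk fun i _ => abs_le.1 (not_lt.1 fun h' => h ⟨i, h'⟩)
  obtain ⟨i, hi⟩ := this
  calc π ^ 2 < |k i| ^ 2 := by
        have := Real.pi_pos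
        exact pow_lt_pow_left₀ hi this.le (by norm_num)
    _ = k i ^ 2 := sq_abs _
    _ ≤ sqNorm k := Finset.single_le_sum (f := fun j => k j ^ 2) (fun j _ => sq_nonneg _) (Finset.mem_univ i)

/-- **Slade (10.38) for the explicit decomposition — the lattice kernel is the continuum kernel up
to `O(t^{-(d-1)})`**: for `d ≥ 1` and every `p` there is `C` (depending on `d, p` only) such that for
all `s ∈ (0,1]`, `t ≥ 1`, `x ∈ ℤ^d`,
`|w(t,x;s) - w_c(t,x;s)| ≤ C · (t²/t^d) · t⁻¹ · (1 + t²s/(2d+s))^{-p}`,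
where `w_c(t,x;s) = (2π)^{-d}∫_{ℝ^d}(t²/(cM²))f(t√((|k|₂²+s)/M²))cos(k·x)dk` is the continuum kernel
(`= (M/t)^{d-2}c⁻¹w̄(Mx/t; st²/M²)` by the change of variables `k = Mu/t`, cf. the sequel). This is
Bauerschmidt's (eq:const-coeff-w-w*-approximation) (`l_x = l_y = 0`): "`φ*_t(x,y;m²) =
φ_t(cx,cy;m²) + O(t^{-(d-2)-1}(1+m²t²)^{-k})`", with his proof: "Proposition 3.1 implies
`∫_{[-π,π]^d}|W*_t(a*(ξ)+m²) - W_t(a*(ξ)+m²)||D̂^l(ξ)|dξ ≤ Ct^{-1}∫_{ℝ^d}(1+C|ξ|²t²+m²t²)^{-p-k}|ξ|^ldξ ≤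
Ct^{-d-l-1}(1+m²t²)^{-k}` … Using (eq:W-decay-derivatives) with `m = 1` and `|a*(ξ) - a(ξ)| = O(|ξ|³)`,
which follows from Taylor's theorem, we obtain `∫|W_t(a*(ξ)+m²) - W_t(a(ξ)+m²)||D̂^l(ξ)|dξ ≤
C∫|ξ|(1+C|ξ|²t²+m²t²)^{-p-k}|ξ|^ldξ ≤ Ct^{-d-l-1}(1+m²t²)^{-k}` … Finally, we obtain by (eq:W-decay) that
`∫_{ℝ^d∖[-π,π]^d}|W_t(a(ξ)+m²)||D̂^l(ξ)|dξ ≤ C∫(1+C|ξ|²t²+m²t²)^{-p-k}|ξ|^ldξ ≤ Ct^{-2p}(1+m²t²)^{-k}`. The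
combination of the previous four inequalities gives (the claim)." (The third of his four
differences concerns `∇̂` vs `D̂` and is void for `l = 0`.)
[cite: Slade2017, §10.3 (display (10.38))] [cite: Bauerschmidt2013, Example 1.3 (display (eq:const-coeff-w-w*-approximation)) and §3.2.2 (its proof)] -/
theorem abs_wKer_sub_wKerCont_le (hd : 1 ≤ d) (p : ℕ) :
    ∃ C : ℝ, 0 < C ∧ ∀ s : ℝ, 0 < s → s ≤ 1 → ∀ t : ℝ, 1 ≤ t → ∀ x : Site d,
      |wKer d s t x - wKerCont d s t x| ≤
        C * (t ^ 2 / t ^ d) * t⁻¹ * ((1 + t ^ 2 * s / (2 * d + s)) ^ p)⁻¹ := by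
  have hd' : (1 : ℝ) ≤ d := by exact_mod_cast hd
  have hc := cProfile_pos
  have hπ := Real.pi_pos
  -- the majorants
  set g : (Fin d → ℝ) → ℝ := fun u => ((1 + ‖u‖ ^ 2) ^ d)⁻¹ with hg
  have hgi : Integrable g := integrable_inv_one_add_norm_sq_pow (by omega)
  have hg0 : ∀ u, 0 ≤ g u := fun u => by positivity
  set h : (Fin d → ℝ) → ℝ := fun u => ‖u‖ ^ 2 * ((1 + ‖u‖ ^ 2) ^ (d + 2))⁻¹ with hh
  have hhi : Integrable h := integrable_norm_pow_mul 2 (by omega)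
  have hh0 : ∀ u, 0 ≤ h u := fun u => by positivity
  set I₁ : ℝ := ∫ u, g u with hI₁
  set I₂ : ℝ := ∫ u, h u with hI₂
  have hI₁0 : 0 ≤ I₁ := integral_nonneg hg0
  have hI₂0 : 0 ≤ I₂ := integral_nonneg hh0
  -- the pointwise constants
  obtain ⟨C₁, hC₁, hcmp1⟩ := abs_wHat_sub_wHatMid_le (d := d) p d
  obtain ⟨C₂, hC₂, hcmp2⟩ := abs_wHatMid_sub_wHatCont_le (d := d) p (d + 2)
  obtain ⟨C₄, hC₄, hcmp4⟩ := abs_wHatCont_le (d := d) p d 1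
  -- the final constant
  set D : ℝ := (2 * (d : ℝ) + 1) ^ d with hD
  have hD1 : 1 ≤ D := one_le_pow₀ (by linarith)
  set Q₁ : ℝ := C₁ * (π / 2) ^ d * I₁ / cProfile with hQ₁
  set Q₂ : ℝ := C₂ * Real.sqrt (20 * d) * (π / 2) ^ d * (π ^ 2 / 4) * I₂ / cProfile with hQ₂
  set Q₄ : ℝ := C₄ * (π / 2) ^ d * I₁ / (cProfile * π ^ 2) with hQ₄
  have hQ₁0 : 0 ≤ Q₁ := by positivity
  have hQ₂0 : 0 ≤ Q₂ := by positivity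
  have hQ₄0 : 0 ≤ Q₄ := by positivity
  refine ⟨((2 * π) ^ d : ℝ)⁻¹ * ((Q₁ + Q₂ + Q₄) * D) + 1, by positivity, fun s hs hs1 t ht x => ?_⟩
  have ht0 : 0 < t := by linarith
  -- atoms `M² = 2d+s`, `M`, `a = 2t/(πM)`, `P = (1+t²s/M²)^{-p}`
  obtain ⟨M2, hM2def⟩ : ∃ z : ℝ, z = 2 * d + s := ⟨_, rfl⟩
  have hM : 0 < M2 := by rw [hM2def]; positivity
  obtain ⟨M, hMdef⟩ : ∃ z : ℝ, z = Real.sqrt M2 := ⟨_, rfl⟩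
  have hM0 : 0 < M := by rw [hMdef]; exact Real.sqrt_pos.2 hM
  have hMsq : M ^ 2 = M2 := by rw [hMdef]; exact Real.sq_sqrt hM.le
  have hM2ge : 1 ≤ M2 := by rw [hM2def]; linarith
  have hMle : M ≤ 2 * d + 1 := by
    rw [hMdef, Real.sqrt_le_iff]
    constructor
    · positivity
    · rw [hM2def]; nlinarith
  have hM1 : 1 ≤ M := by
    rw [hMdef, Real.one_le_sqrt]; exact hM2ge
  have hMd : M ^ d ≤ D := pow_le_pow_left₀ hM0.le hMle d
  have hMd1 : M ^ (d - 1) ≤ D := (pow_le_pow_right₀ hM1 (Nat.sub_le d 1)).trans hMd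
  obtain ⟨a, ha⟩ : ∃ z : ℝ, z = 2 * t / (π * M) := ⟨_, rfl⟩
  have ha0 : 0 < a := by rw [ha]; positivity
  obtain ⟨P, hPdef⟩ : ∃ z : ℝ, z = ((1 + t ^ 2 * s / M2) ^ p)⁻¹ := ⟨_, rfl⟩
  have hP0 : 0 < P := by rw [hPdef]; positivity
  have had : (a ^ d)⁻¹ = (π / 2) ^ d * (M ^ d / t ^ d) := by
    rw [ha, div_pow, mul_pow, inv_div, div_pow, mul_pow]
    field_simp
  have ha2 : (a ^ 2)⁻¹ = π ^ 2 * M ^ 2 / (4 * t ^ 2) := by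
    rw [ha]
    field_simp
    ring
  -- the three comparisons, folded into the atoms
  have hc1 : ∀ k ∈ brillouin d, |wHat d s t k - wHatMid d s t k| ≤
      t ^ 2 / (cProfile * M2) * (C₁ * t⁻¹) * P * g (a • k) := by
    intro k hk
    have h1 := hcmp1 s hs t ht k hk
    rw [← hM2def, ← hMdef, ← ha, ← hPdef] at h1
    exact h1
  have hc2 : ∀ k ∈ brillouin d, |wHatMid d s t k - wHatCont d s t k| ≤
      t ^ 2 / (cProfile * M2) * (C₂ * t * (Real.sqrt (20 * d) / M)) * P *
        (‖k‖ ^ 2 * ((1 + ‖a • k‖ ^ 2) ^ (d + 2))⁻¹) := by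
    intro k hk
    have h1 := hcmp2 s hs t ht k hk
    rw [← hM2def, ← hMdef, ← ha, ← hPdef] at h1
    exact h1
  have hc4 : ∀ k : Fin d → ℝ, |wHatCont d s t k| ≤
      t ^ 2 / (cProfile * M2) * C₄ * P * ((1 + t ^ 2 * sqNorm k / M2) ^ 1)⁻¹ * g (a • k) := by
    intro k
    have h1 := hcmp4 s hs t ht0.le k
    rw [← hM2def, ← hMdef, ← ha, ← hPdef] at h1
    exact h1
  -- the symbols and their measurability
  have hwi : Integrable (fun k : Fin d → ℝ => wHat d s t k)
      ((volume : Measure (Fin d → ℝ)).restrict (brillouin d)) := by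
    have := integrable_wHat_mul_cos hs ht0 (0 : Site d)
    refine this.congr (Eventually.of_forall fun k => ?_)
    simp [phase]
  have hmidc := continuous_wHatMid (d := d) s t
  have hcontc := continuous_wHatCont (d := d) s t
  -- T1: `∫_B |ŵ - ŵ_mid| ≤ K₁ a^{-d} I₁`
  obtain ⟨K₁, hK₁⟩ : ∃ K : ℝ, K = t ^ 2 / (cProfile * M2) * (C₁ * t⁻¹) * P := ⟨_, rfl⟩
  have hK₁0 : 0 ≤ K₁ := by rw [hK₁]; positivity
  have hT1 := setIntegral_le_of_le_mul_comp_smul (measurableSet_brillouin d)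
    (F := fun k => ‖wHat d s t k - wHatMid d s t k‖) (g := g)
    ((hwi.aestronglyMeasurable.sub hmidc.aestronglyMeasurable).norm) (fun k _ => norm_nonneg _)
    hgi hg0 hK₁0 ha0 (fun k hk => by
      rw [Real.norm_eq_abs, hK₁]
      exact hc1 k hk)
  -- T2: `∫_B |ŵ_mid - ŵ_c| ≤ K₂ a^{-d} I₂`
  obtain ⟨K₂, hK₂⟩ : ∃ K : ℝ,
      K = t ^ 2 / (cProfile * M2) * (C₂ * t * (Real.sqrt (20 * d) / M)) * P * (a ^ 2)⁻¹ := ⟨_, rfl⟩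
  have hK₂0 : 0 ≤ K₂ := by rw [hK₂]; positivity
  have hT2 := setIntegral_le_of_le_mul_comp_smul (measurableSet_brillouin d)
    (F := fun k => ‖wHatMid d s t k - wHatCont d s t k‖) (g := h)
    ((hmidc.aestronglyMeasurable.sub hcontc.aestronglyMeasurable).norm) (fun k _ => norm_nonneg _)
    hhi hh0 hK₂0 ha0 (fun k hk => by
      rw [Real.norm_eq_abs]
      refine (hc2 k hk).trans (le_of_eq ?_)
      simp only [hh]
      rw [norm_smul, Real.norm_eq_abs, abs_of_pos ha0, mul_pow, hK₂]
      have hane : a ^ 2 ≠ 0 := pow_ne_zero 2 ha0.ne'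
      field_simp)
  -- T4: `∫_{Bᶜ} |ŵ_c| ≤ K₄ a^{-d} I₁`
  obtain ⟨K₄, hK₄⟩ : ∃ K : ℝ, K = t ^ 2 / (cProfile * M2) * C₄ * P * (M2 / (t ^ 2 * π ^ 2)) := ⟨_, rfl⟩
  have hK₄0 : 0 ≤ K₄ := by rw [hK₄]; positivity
  have hT4 := setIntegral_le_of_le_mul_comp_smul (measurableSet_brillouin d).compl
    (F := fun k => ‖wHatCont d s t k‖) (g := g) hcontc.aestronglyMeasurable.norm
    (fun k _ => norm_nonneg _) hgi hg0 hK₄0 ha0 (fun k hk => by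
      rw [Real.norm_eq_abs, hK₄]
      have h1 := hc4 k
      have hsq := pi_sq_lt_sqNorm_of_not_mem hk
      -- `(1 + t²|k|₂²/M²)⁻¹ ≤ M²/(t²π²)`
      have h2 : ((1 + t ^ 2 * sqNorm k / M2) ^ 1)⁻¹ ≤ M2 / (t ^ 2 * π ^ 2) := by
        rw [pow_one, inv_le_comm₀ (by have := sqNorm_nonneg k; positivity) (by positivity), inv_div,
          div_le_iff₀ hM]
        have : t ^ 2 * π ^ 2 ≤ t ^ 2 * sqNorm k := mul_le_mul_of_nonneg_left hsq.le (sq_nonneg t)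
        have e : (1 + t ^ 2 * sqNorm k / M2) * M2 = M2 + t ^ 2 * sqNorm k := by field_simp
        rw [e]
        linarith
      calc |wHatCont d s t k| ≤ t ^ 2 / (cProfile * M2) * C₄ * P * ((1 + t ^ 2 * sqNorm k / M2) ^ 1)⁻¹ *
            g (a • k) := h1
        _ ≤ t ^ 2 / (cProfile * M2) * C₄ * P * (M2 / (t ^ 2 * π ^ 2)) * g (a • k) := by
            gcongr)
  -- integrability of `ŵ_c cos` on `ℝ^d` (for splitting the continuum integral)
  have hcci : Integrable fun k : Fin d → ℝ => wHatCont d s t k * Real.cos (phase k x) := by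
    have hbound : ∀ k, |wHatCont d s t k * Real.cos (phase k x)| ≤
        t ^ 2 / (cProfile * M2) * C₄ * P * g (a • k) := by
      intro k
      rw [abs_mul]
      refine (mul_le_of_le_one_right (abs_nonneg _) (Real.abs_cos_le_one _)).trans ?_
      refine (hc4 k).trans ?_
      have h1 : ((1 + t ^ 2 * sqNorm k / M2) ^ 1)⁻¹ ≤ 1 := by
        apply inv_le_one_of_one_le₀
        rw [pow_one]
        have := sqNorm_nonneg k
        have : 0 ≤ t ^ 2 * sqNorm k / M2 := by positivity
        linarith
      calc t ^ 2 / (cProfile * M2) * C₄ * P * ((1 + t ^ 2 * sqNorm k / M2) ^ 1)⁻¹ * g (a • k)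
          ≤ t ^ 2 / (cProfile * M2) * C₄ * P * 1 * g (a • k) := by gcongr
        _ = _ := by ring
    refine Integrable.mono' (((hgi.comp_smul ha0.ne').const_mul (t ^ 2 / (cProfile * M2) * C₄ * P)))
      ((hcontc.mul (Real.continuous_cos.comp (continuous_phase x))).aestronglyMeasurable)
      (Eventually.of_forall fun k => by rw [Real.norm_eq_abs]; exact hbound k)
  have hwci : Integrable (fun k : Fin d → ℝ => wHat d s t k * Real.cos (phase k x))
      ((volume : Measure (Fin d → ℝ)).restrict (brillouin d)) := integrable_wHat_mul_cos hs ht0 x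
  -- decomposition of the difference
  have hsplit : wKer d s t x - wKerCont d s t x = ((2 * π) ^ d : ℝ)⁻¹ *
      ((∫ k in brillouin d, (wHat d s t k - wHatCont d s t k) * Real.cos (phase k x)) -
        ∫ k in (brillouin d)ᶜ, wHatCont d s t k * Real.cos (phase k x)) := by
    unfold wKer wKerCont
    rw [← integral_add_compl (measurableSet_brillouin d) hcci, ← mul_sub]
    congr 1
    have e : ∫ k in brillouin d, (wHat d s t k - wHatCont d s t k) * Real.cos (phase k x) =
        (∫ k in brillouin d, wHat d s t k * Real.cos (phase k x)) -
          ∫ k in brillouin d, wHatCont d s t k * Real.cos (phase k x) := by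
      rw [← integral_sub hwci hcci.integrableOn]
      exact integral_congr_ae (Eventually.of_forall fun k => by ring)
    rw [e]
    ring
  -- the two integral bounds
  have hB1 : |∫ k in brillouin d, (wHat d s t k - wHatCont d s t k) * Real.cos (phase k x)| ≤
      K₁ * ((a ^ d)⁻¹ * I₁) + K₂ * ((a ^ d)⁻¹ * I₂) := by
    have hFG : IntegrableOn (fun k => ‖wHat d s t k - wHatMid d s t k‖ + ‖wHatMid d s t k - wHatCont d s t k‖)
        (brillouin d) := hT1.1.add hT2.1
    have hle : ∀ k, ‖(wHat d s t k - wHatCont d s t k) * Real.cos (phase k x)‖ ≤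
        ‖wHat d s t k - wHatMid d s t k‖ + ‖wHatMid d s t k - wHatCont d s t k‖ := by
      intro k
      rw [norm_mul]
      refine (mul_le_of_le_one_right (norm_nonneg _) ?_).trans ?_
      · rw [Real.norm_eq_abs]; exact Real.abs_cos_le_one _
      · have e : wHat d s t k - wHatCont d s t k =
            (wHat d s t k - wHatMid d s t k) + (wHatMid d s t k - wHatCont d s t k) := by ring
        rw [e]
        exact norm_add_le _ _
    have h1 := norm_integral_le_of_norm_le hFG (Eventually.of_forall hle)
    rw [Real.norm_eq_abs, integral_add hT1.1 hT2.1] at h1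
    exact h1.trans (add_le_add hT1.2 hT2.2)
  have hB2 : |∫ k in (brillouin d)ᶜ, wHatCont d s t k * Real.cos (phase k x)| ≤ K₄ * ((a ^ d)⁻¹ * I₁) := by
    have hle : ∀ k, ‖wHatCont d s t k * Real.cos (phase k x)‖ ≤ ‖wHatCont d s t k‖ := by
      intro k
      rw [norm_mul]
      refine mul_le_of_le_one_right (norm_nonneg _) ?_
      rw [Real.norm_eq_abs]; exact Real.abs_cos_le_one _
    have h1 := norm_integral_le_of_norm_le hT4.1 (Eventually.of_forall hle)
    rw [Real.norm_eq_abs] at h1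
    exact h1.trans hT4.2
  -- evaluate the three majorant constants
  have hX : 0 ≤ (t ^ 2 / t ^ d) * t⁻¹ * P := by positivity
  have hE1 : K₁ * ((a ^ d)⁻¹ * I₁) ≤ Q₁ * D * ((t ^ 2 / t ^ d) * t⁻¹ * P) := by
    have e : K₁ * ((a ^ d)⁻¹ * I₁) = Q₁ * (M ^ d / M2) * ((t ^ 2 / t ^ d) * t⁻¹ * P) := by
      rw [hK₁, had, hQ₁]; ring
    rw [e]
    have h1 : M ^ d / M2 ≤ D := by
      rw [div_le_iff₀ hM]
      calc M ^ d ≤ D := hMd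
        _ = D * 1 := (mul_one D).symm
        _ ≤ D * M2 := mul_le_mul_of_nonneg_left hM2ge (by positivity)
    exact mul_le_mul_of_nonneg_right (mul_le_mul_of_nonneg_left h1 hQ₁0) hX
  have hE2 : K₂ * ((a ^ d)⁻¹ * I₂) ≤ Q₂ * D * ((t ^ 2 / t ^ d) * t⁻¹ * P) := by
    have e : K₂ * ((a ^ d)⁻¹ * I₂) = Q₂ * (M ^ d * M ^ 2 / (M2 * M)) * ((t ^ 2 / t ^ d) * t⁻¹ * P) := by
      rw [hK₂, had, ha2, hQ₂]
      field_simp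
    rw [e]
    have h1 : M ^ d * M ^ 2 / (M2 * M) ≤ D := by
      rw [hMsq, div_le_iff₀ (by positivity)]
      have hdsucc : M ^ d = M ^ (d - 1) * M := by
        rw [← pow_succ, Nat.sub_add_cancel hd]
      rw [hdsucc]
      have : M ^ (d - 1) * M * M2 ≤ D * M * M2 := by gcongr
      linarith [this]
    exact mul_le_mul_of_nonneg_right (mul_le_mul_of_nonneg_left h1 hQ₂0) hX
  have hE4 : K₄ * ((a ^ d)⁻¹ * I₁) ≤ Q₄ * D * ((t ^ 2 / t ^ d) * t⁻¹ * P) := by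
    have e : K₄ * ((a ^ d)⁻¹ * I₁) = Q₄ * M ^ d * ((t ^ d)⁻¹ * P) := by
      rw [hK₄, had, hQ₄]
      field_simp
    rw [e]
    have h1 : (t ^ d)⁻¹ * P ≤ (t ^ 2 / t ^ d) * t⁻¹ * P := by
      have e : (t ^ 2 / t ^ d) * t⁻¹ * P = t * ((t ^ d)⁻¹ * P) := by
        field_simp
      rw [e]
      exact le_mul_of_one_le_left (by positivity) ht
    calc Q₄ * M ^ d * ((t ^ d)⁻¹ * P) ≤ Q₄ * D * ((t ^ d)⁻¹ * P) := by gcongr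
      _ ≤ Q₄ * D * ((t ^ 2 / t ^ d) * t⁻¹ * P) := mul_le_mul_of_nonneg_left h1 (by positivity)
  -- assemble
  have hπd : (0 : ℝ) < ((2 * π) ^ d : ℝ)⁻¹ := by positivity
  rw [← hM2def, ← hPdef, hsplit, abs_mul, abs_of_pos hπd]
  calc ((2 * π) ^ d : ℝ)⁻¹ * |(∫ k in brillouin d, (wHat d s t k - wHatCont d s t k) * Real.cos (phase k x)) -
        ∫ k in (brillouin d)ᶜ, wHatCont d s t k * Real.cos (phase k x)|
      ≤ ((2 * π) ^ d : ℝ)⁻¹ * (K₁ * ((a ^ d)⁻¹ * I₁) + K₂ * ((a ^ d)⁻¹ * I₂) + K₄ * ((a ^ d)⁻¹ * I₁)) := by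
        refine mul_le_mul_of_nonneg_left ((abs_sub _ _).trans (add_le_add hB1 hB2)) hπd.le
    _ ≤ ((2 * π) ^ d : ℝ)⁻¹ * (Q₁ * D * ((t ^ 2 / t ^ d) * t⁻¹ * P) + Q₂ * D * ((t ^ 2 / t ^ d) * t⁻¹ * P) +
          Q₄ * D * ((t ^ 2 / t ^ d) * t⁻¹ * P)) :=
        mul_le_mul_of_nonneg_left (add_le_add (add_le_add hE1 hE2) hE4) hπd.le
    _ = ((2 * π) ^ d : ℝ)⁻¹ * ((Q₁ + Q₂ + Q₄) * D) * (t ^ 2 / t ^ d) * t⁻¹ * P := by ring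
    _ ≤ (((2 * π) ^ d : ℝ)⁻¹ * ((Q₁ + Q₂ + Q₄) * D) + 1) * (t ^ 2 / t ^ d) * t⁻¹ * P := by
        have e : (((2 * π) ^ d : ℝ)⁻¹ * ((Q₁ + Q₂ + Q₄) * D) + 1) * (t ^ 2 / t ^ d) * t⁻¹ * P =
            ((2 * π) ^ d : ℝ)⁻¹ * ((Q₁ + Q₂ + Q₄) * D) * (t ^ 2 / t ^ d) * t⁻¹ * P +
              (t ^ 2 / t ^ d) * t⁻¹ * P := by ring
        rw [e]
        linarith

/-! ### The self-similar form of the continuum kernel -/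

/-- **Bauerschmidt's scaling function for our profile**: `w̄(y;σ) = (2π)^{-d}∫_{ℝ^d} f(√(|u|₂²+σ))
cos(u·y) du` (`f = Re profile`) — "`φ̄(x;a,m²) := ∫_{ℝ^d}W_1(a(ξ)+m²)e^{ix·ξ}dξ`" (his (eq:w-wbar),
identity coefficients, real form), Slade's `w̄` of (10.38) up to the normalisation recorded in
`wKerCont_eq_scaling`. [cite: Bauerschmidt2013, §3.2.2 (display (eq:w-wbar) defining φ̄)] [cite: Slade2017, §10.3 (display (10.38): "w̄ is φ̄ of [Baue13a]")] -/
def wbar (d : ℕ) (σ : ℝ) (y : Fin d → ℝ) : ℝ :=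
  ((2 * π) ^ d : ℝ)⁻¹ * ∫ u : Fin d → ℝ, (profile (Real.sqrt (sqNorm u + σ))).re * Real.cos (∑ i, u i * y i)

/-- `|b·u|₂² = b²|u|₂²`. [folklore] -/
theorem sqNorm_smul (b : ℝ) (u : Fin d → ℝ) : sqNorm (b • u) = b ^ 2 * sqNorm u := by
  unfold sqNorm
  rw [Finset.mul_sum]
  exact Finset.sum_congr rfl fun i _ => by rw [Pi.smul_apply, smul_eq_mul]; ring

/-- **Scale invariance of the continuum kernel** ("`φ_t(x,y;a,m²) = t^{-(d-2)}φ̄((x-y)/t; a, m²t²)`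
… this is scale invariance"): with `M² = 2d+s`, `M = √(M²)`,
`w_c(t,x;s) = (M/t)^d (t²/(cM²)) w̄(Mx/t; st²/M²)` — the change of variables `k = (M/t)u` in the
Fourier integral (so `w_c(t,x;s) = c⁻¹(M/t)^{d-2} w̄(Mx/t; st²/M²)`, Slade's `(c/t)^{d-2}w̄(cx/t; st²)`
of (10.38) with the constant `c ↔ M` and the normalisation `c⁻¹ = cProfile⁻¹`).
[cite: Bauerschmidt2013, §3.2.2 (displays (eq:const-coeff-w-hom)/(eq:w-wbar): "by the change of variables ξ ↦ tξ … this is scale invariance")] [cite: Slade2017, §10.3 (display (10.38))] -/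
theorem wKerCont_eq_scaling (hd : 1 ≤ d) {s : ℝ} (hs : 0 ≤ s) {t : ℝ} (ht : 0 < t) (x : Site d) :
    wKerCont d s t x = (Real.sqrt (2 * d + s) / t) ^ d * (t ^ 2 / (cProfile * (2 * d + s))) *
      wbar d (s * t ^ 2 / (2 * d + s)) (fun i => Real.sqrt (2 * d + s) * (x i : ℝ) / t) := by
  have hd' : (0 : ℝ) < d := by exact_mod_cast hd
  have hM2 : 0 < 2 * (d : ℝ) + s := by positivity
  set M : ℝ := Real.sqrt (2 * d + s) with hM
  have hM0 : 0 < M := Real.sqrt_pos.2 hM2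
  have hMsq : M ^ 2 = 2 * d + s := Real.sq_sqrt hM2.le
  set b : ℝ := M / t with hb
  have hb0 : 0 < b := by positivity
  set G : (Fin d → ℝ) → ℝ := fun k => wHatCont d s t k * Real.cos (phase k x) with hG
  have hcomp := Measure.integral_comp_smul volume G b
  rw [Module.finrank_fin_fun, abs_of_nonneg (inv_nonneg.2 (pow_nonneg hb0.le _)), smul_eq_mul] at hcomp
  have hint : ∫ k, G k = b ^ d * ∫ u, G (b • u) := by
    rw [hcomp, ← mul_assoc, mul_inv_cancel₀ (pow_ne_zero d hb0.ne'), one_mul]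
  -- the integrand at `k = (M/t)u`
  have hpt : ∀ u : Fin d → ℝ, G (b • u) = t ^ 2 / (cProfile * (2 * d + s)) *
      ((profile (Real.sqrt (sqNorm u + s * t ^ 2 / (2 * d + s)))).re *
        Real.cos (∑ i, u i * (M * (x i : ℝ) / t))) := by
    intro u
    have hX0 : 0 ≤ (b ^ 2 * sqNorm u + s) / (2 * d + s) :=
      div_nonneg (add_nonneg (mul_nonneg (sq_nonneg b) (sqNorm_nonneg u)) hs) hM2.le
    have e1 : t * Real.sqrt ((b ^ 2 * sqNorm u + s) / (2 * d + s)) =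
        Real.sqrt (sqNorm u + s * t ^ 2 / (2 * d + s)) := by
      calc t * Real.sqrt ((b ^ 2 * sqNorm u + s) / (2 * d + s))
          = Real.sqrt (t ^ 2) * Real.sqrt ((b ^ 2 * sqNorm u + s) / (2 * d + s)) := by
            rw [Real.sqrt_sq ht.le]
        _ = Real.sqrt (t ^ 2 * ((b ^ 2 * sqNorm u + s) / (2 * d + s))) := (Real.sqrt_mul' _ hX0).symm
        _ = Real.sqrt (sqNorm u + s * t ^ 2 / (2 * d + s)) := by
            congr 1
            rw [hb, div_pow, hMsq]
            field_simp
    have e2 : (∑ i, (b • u) i * (x i : ℝ)) = ∑ i, u i * (M * (x i : ℝ) / t) :=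
      Finset.sum_congr rfl fun i _ => by rw [Pi.smul_apply, smul_eq_mul, hb]; ring
    simp only [hG, wHatCont, phase]
    rw [sqNorm_smul, e1, e2]
    ring
  unfold wKerCont wbar
  rw [show (fun k => wHatCont d s t k * Real.cos (phase k x)) = G from rfl, hint,
    integral_congr_ae (Eventually.of_forall hpt), integral_const_mul, hb]
  ring

end FRD

end LongRangePhi4

end Literature.Barriers.CriticalPhenomena
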